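/-
Copyright (c) 2026 the pub-hodgecm-mathlib formalisation cell (harness21).  Prover seat hodgecm-mathlib-F0P3b-p01 (g12): «S3-ram» seeding wave (LEAD T11-41 ∕ T11-45 (1),
owner F0P3a-p06 (g15)), row «C-Δram» — the `Δ‴` Cayley-shift law at a TAME non-split place, ramified allowed; 2026-09-01.
-/
import Literature.NumberTheory.Rogawski1990.FinExplicitTransferFactorDeepTauTamePairs   -- ★ T5-u-TAME (F0P3a-p04): `exists_forall_finExplicitDelta_eq_hilbertSymbol_mul_of_deep`
import Literature.NumberTheory.Rogawski1990.FinExplicitTransferFactorCayleyShift        -- ★ p846459 (F0P2-p02): `finKappaAt_eq_of_shared_eigenvector` (place-free κ-half)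
import Literature.NumberTheory.QuadraticForms.HilbertSymbolLocallyConstant                -- ★ `hilbertSymbol_eq_of_valued_sub_lt` (local constancy of `(·, θ)_v`)
import HarnessLib

/-!
# `Δ‴_v(γ_H, γ′) = q_v⁻² · Δ‴_v(u_H, u′)` under a two-step drop of the depth token at a TAME non-split place (ramified allowed)
# (Rogawski 1990 §4.9 Prop. 4.9.1; Kottwitz 1986 §3)

Topic `NumberTheory/Rogawski1990`; namespace `Literature.NumberTheory.Rogawski1990`.  THEOREMS ONLY (no definition, no instance, no notation, no named fact, no `sorry`);
kernel lane `--supports stmt-HodgeConjecture-24833`.  Cell `pub/hodgecm-mathlib` (D-0151), crux H413; «S3-ram» seeding wave (LEAD F0P3a-plan (g12) T11-41∕T11-45, owner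
F0P3a-p06 (g15)), row «C-Δram»: the RAMIFIED-CAPABLE twin of ★ p846459 `finExplicitDelta_eq_inv_sq_mul_of_log_eq` (which binds `hunr hμ`).  HONEST LABEL: HC_CM is proved
only modulo the 2 remaining named inputs (hLiu418 24832, h413 24833) until rung 0 closes; unconditional local algebra over ★ organs, no consumer tonight (seed capital
for the ramified LIFT), count-neutral.

THE MATHEMATICS.  At a tame non-split `v` (`|2|_w = 1`, `w` the place over `v`, inert OR ramified) ★ T5-u-TAME gives, for `γ_H` deep (`|u_w − 1|, |det g_w − 1| ≤ |ι_w ϖ_v|^{M₀}`)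
and `γ′` matched with `ι_v(γ_H)`: `Δ‴_v(γ_H, γ′) = (β(γ_H), θ)_v · q_v^{−m} · κ_v(γ_H, γ′)`, where `|χ_g(u)_w|_w = |ι_w ϖ_v|_w^m` and `ι_w β(γ_H) = −χ_g(u)_w (u_w² + det g_w) ∕
(2 u_w² det g_w)` — with NO unramifiedness of `v` and NO hypothesis on `μ_w` (the `∃ M₀` absorbs the conductor by continuity).  Hence (§1) for two deep elements `γ_H, u_H` with
matched `γ′, u′` sharing an eigenvector on the `u`-eigenlines (so `κ_v(γ_H, γ′) = κ_v(u_H, u′)`, ★ `finKappaAt_eq_of_shared_eigenvector`, place-free), depth tokens `m = m′ + 2`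
and `(β(γ_H), θ)_v = (β(u_H), θ)_v`: **`Δ‴_v(γ_H, γ′) = q_v⁻² · Δ‴_v(u_H, u′)`** — the currency of the inert LIFT's (A3) ★ `finsum_finExplicitDelta_mul_eq_inv_sq_mul_finsum_shift`.
§2: `(β′, θ)_v = (β, θ)_v` whenever `β′c² = βε`, `|ε − 1|_v < 1` (local constancy of the Hilbert symbol).  §3 (any valued field, root-free, type-free, in
trace–determinant coordinates): under the Möbius shift `φ_c` (`a = c+1`, `b = c−1`; `u′(bu+a) = au+b`, `t′`, `D′` from `(ag+b)(bg+a)⁻¹`) the identity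
`χ′(u′)(bu+a)² det(bg+a) = (a²−b²)² χ(u)` and, for `u, g` deep against `c²`, the two DISCHARGERS `|χ′(u′)| = |χ(u)|∕|c|²` (so `m′ = m − 2` when `c = ϖ_v`) and
`β′c² = β·ε`, `|ε − 1| < 1` (so `(β′, θ)_v = (β, θ)_v` by §2, read in `L⁺_v` through ★ `valued_toPlace`).

## References
* [Rogawski1990] J. D. Rogawski, *Automorphic Representations of Unitary Groups in Three Variables*, Ann. of Math. Stud. 123 (1990): §4.9 p. 55, Prop. 4.9.1 (a)(b);
  §4.3 (4.3.2) p. 43; Prop. 8.1.3 p. 116.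
* [Kottwitz1986] R. E. Kottwitz, *Base change for unit elements of Hecke algebras*, Compositio Math. 60 (1986): §3.
* [LabesseLanglands1979] J.-P. Labesse, R. P. Langlands, *L-indistinguishability for SL(2)*, Canad. J. Math. 31 (1979): §2.
-/

set_option autoImplicit false

noncomputable section

open NumberField IsDedekindDomain Filter Topology Matrix
open scoped WithZero

namespace Literature.NumberTheory.Rogawski1990

open Literature.NumberTheory.Automorphic Literature.NumberTheory.Automorphic.UnitaryGroup Literature.NumberTheory.GaloisRepresentations
open Literature.NumberTheory.QuadraticForms

/-! ## §1 The shift law in `(β, m)`-currency: `Δ‴_v(γ_H, γ′) = q_v⁻² · Δ‴_v(u_H, u′)` -/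

open scoped Classical in
/-- **`Δ‴_v(γ_H, γ′) = q_v⁻² · Δ‴_v(u_H, u′)` AT A TAME NON-SPLIT PLACE, RAMIFIED ALLOWED** (`q_v = #k_v`): there is a deepness exponent `M₀ ≥ 1` (★ T5-u-TAME's) such that
for `γ_H, u_H` both `M₀`-deep, with depth tokens `|χ_g(u)_w|_w = |ι_w ϖ_v|_w^m`, `|χ_{g′}(u′)_w|_w = |ι_w ϖ_v|_w^{m′}`, `m = m′ + 2`, symmetrised discriminants `β, β′`
with `(β, θ)_v = (β′, θ)_v`, and matched `γ′ ↔ ι_v(γ_H)`, `u′ ↔ ι_v(u_H)` sharing a non-zero vector `p′` on the `u`-eigenlines: `Δ‴_v(γ_H, γ′) = q_v⁻²·Δ‴_v(u_H, u′)`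
(★ `exists_forall_finExplicitDelta_eq_hilbertSymbol_mul_of_deep` on both sides, ★ `finKappaAt_eq_of_shared_eigenvector`).  No `hunr`, no hypothesis on `μ_w`.
[cite: Rogawski1990, §4.9 p. 55, Prop. 4.9.1 (a)(b); §4.3 (4.3.2) p. 43] [cite: Kottwitz1986, §3] -/
theorem exists_forall_finExplicitDelta_eq_inv_sq_mul_of_hilbertSymbol_eq
    (L : Type) [Field L] [NumberField L] [IsCMField L] (v : HeightOneSpectrum (𝓞 ↥(maximalRealSubfield L)))
    (w : PlacesOver L v) (hw : IsCMField.complexConj L • w.1 = w.1) (μ : HeckeCharacter L)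
    (hμω : ∀ x : ideleGroup ↥(maximalRealSubfield L), μ (AdeleRing.ideleBaseChange ↥(maximalRealSubfield L) L x) = quadraticHeckeCharCM L x)
    (h2 : Valued.v (2 : w.1.adicCompletion L) = 1) (H' : Matrix (Fin 3) (Fin 3) L) :
    ∃ M₀ : ℕ, 1 ≤ M₀ ∧
      ∀ (γH uH : (cmDatum L 2 (Matrix.of fun i j : Fin 2 => if i.val + j.val + 1 = 2 then (1 : L) else 0)).Local v ×
          (cmDatum L 1 (Matrix.of fun i j : Fin 1 => if i.val + j.val + 1 = 1 then (1 : L) else 0)).Local v) (m m' : ℕ)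
        (γ' u' : (cmDatum L 3 H').Local v),
        -- depth tokens, two steps apart
        Valued.v (((finCharpolyTwo L v γH).eval (finGammaTwo L v γH)) w) =
          Valued.v ((toPlace v w (HeckeCharacter.uniformizer ↥(maximalRealSubfield L) v : v.adicCompletion ↥(maximalRealSubfield L))) ^ m) →
        Valued.v (((finCharpolyTwo L v uH).eval (finGammaTwo L v uH)) w) =
          Valued.v ((toPlace v w (HeckeCharacter.uniformizer ↥(maximalRealSubfield L) v : v.adicCompletion ↥(maximalRealSubfield L))) ^ m') →
        m = m' + 2 →
        -- both elements deep
        Valued.v (finGammaTwo L v γH w - 1) ≤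
          Valued.v ((toPlace v w (HeckeCharacter.uniformizer ↥(maximalRealSubfield L) v : v.adicCompletion ↥(maximalRealSubfield L))) ^ M₀) →
        Valued.v (((γH.1.val.val : Matrix (Fin 2) (Fin 2) (LocalRing L v)).map
            (Pi.evalRingHom (fun w' : PlacesOver L v => w'.1.adicCompletion L) w)).det - 1) ≤
          Valued.v ((toPlace v w (HeckeCharacter.uniformizer ↥(maximalRealSubfield L) v : v.adicCompletion ↥(maximalRealSubfield L))) ^ M₀) →
        Valued.v (finGammaTwo L v uH w - 1) ≤
          Valued.v ((toPlace v w (HeckeCharacter.uniformizer ↥(maximalRealSubfield L) v : v.adicCompletion ↥(maximalRealSubfield L))) ^ M₀) →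
        Valued.v (((uH.1.val.val : Matrix (Fin 2) (Fin 2) (LocalRing L v)).map
            (Pi.evalRingHom (fun w' : PlacesOver L v => w'.1.adicCompletion L) w)).det - 1) ≤
          Valued.v ((toPlace v w (HeckeCharacter.uniformizer ↥(maximalRealSubfield L) v : v.adicCompletion ↥(maximalRealSubfield L))) ^ M₀) →
        -- the symmetrised discriminants and the Hilbert-symbol match
        ∀ β β' : (v.adicCompletion ↥(maximalRealSubfield L))ˣ,
          toPlace v w (β : v.adicCompletion ↥(maximalRealSubfield L)) =
            -(((finCharpolyTwo L v γH).eval (finGammaTwo L v γH)) w *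
                (finGammaTwo L v γH w ^ 2 +
                  ((γH.1.val.val : Matrix (Fin 2) (Fin 2) (LocalRing L v)).map (Pi.evalRingHom (fun w' : PlacesOver L v => w'.1.adicCompletion L) w)).det)) /
              (2 * finGammaTwo L v γH w ^ 2 *
                ((γH.1.val.val : Matrix (Fin 2) (Fin 2) (LocalRing L v)).map (Pi.evalRingHom (fun w' : PlacesOver L v => w'.1.adicCompletion L) w)).det) →
          toPlace v w (β' : v.adicCompletion ↥(maximalRealSubfield L)) =
            -(((finCharpolyTwo L v uH).eval (finGammaTwo L v uH)) w *
                (finGammaTwo L v uH w ^ 2 +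
                  ((uH.1.val.val : Matrix (Fin 2) (Fin 2) (LocalRing L v)).map (Pi.evalRingHom (fun w' : PlacesOver L v => w'.1.adicCompletion L) w)).det)) /
              (2 * finGammaTwo L v uH w ^ 2 *
                ((uH.1.val.val : Matrix (Fin 2) (Fin 2) (LocalRing L v)).map (Pi.evalRingHom (fun w' : PlacesOver L v => w'.1.adicCompletion L) w)).det) →
          hilbertSymbol (v.adicCompletion ↥(maximalRealSubfield L)) (β : v.adicCompletion ↥(maximalRealSubfield L))
              (algebraMap ↥(maximalRealSubfield L) _ ((cmQuadraticGenerator L : 𝓞 ↥(maximalRealSubfield L)) : ↥(maximalRealSubfield L))) =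
            hilbertSymbol (v.adicCompletion ↥(maximalRealSubfield L)) (β' : v.adicCompletion ↥(maximalRealSubfield L))
              (algebraMap ↥(maximalRealSubfield L) _ ((cmQuadraticGenerator L : 𝓞 ↥(maximalRealSubfield L)) : ↥(maximalRealSubfield L))) →
        -- matched pairs sharing an eigenvector on the `u`-eigenlines
        IsLocalNormPair L H' v γH γ' → IsLocalNormPair L H' v uH u' →
        ∀ {p' : Fin 3 → LocalRing L v}, p' ≠ 0 →
          (γ'.val.val : Matrix (Fin 3) (Fin 3) (LocalRing L v)) *ᵥ p' = finGammaTwo L v γH • p' →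
          (u'.val.val : Matrix (Fin 3) (Fin 3) (LocalRing L v)) *ᵥ p' = finGammaTwo L v uH • p' →
        finExplicitDelta L v H' γH μ γ' = (((Nat.card (𝓞 ↥(maximalRealSubfield L) ⧸ v.asIdeal) : ℂ)) ^ 2)⁻¹ * finExplicitDelta L v H' uH μ u' := by
  classical
  obtain ⟨M₀, hM₁, h⟩ := exists_forall_finExplicitDelta_eq_hilbertSymbol_mul_of_deep L v w hw μ hμω h2 H'
  refine ⟨M₀, hM₁, fun γH uH m m' γ' u' hχ hχ' hmm hud hdd hud' hdd' β β' hβ hβ' hββ' hpair hpair' p' hne hp hp' => ?_⟩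
  have hvs : Subsingleton (PlacesOver L v) := PlacesOver.subsingleton_of_smul_eq (IsCMField.complexConj L) (IsCMField.complexConj_ne_one L) w hw
  have hϖ0 : (toPlace v w (HeckeCharacter.uniformizer ↥(maximalRealSubfield L) v : v.adicCompletion ↥(maximalRealSubfield L))) ≠ 0 :=
    toPlace_heckeUniformizer_ne_zero L v w
  -- the `χ`-values are units (non-zero at the one place `w`)
  have hunit : ∀ {x : LocalRing L v} {n : ℕ}, Valued.v (x w) =
      Valued.v ((toPlace v w (HeckeCharacter.uniformizer ↥(maximalRealSubfield L) v : v.adicCompletion ↥(maximalRealSubfield L))) ^ n) → IsUnit x := by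
    intro x n hx
    have hx0 : x w ≠ 0 := fun h0 => by
      rw [h0, map_zero] at hx
      exact (Valuation.ne_zero_iff _).2 (pow_ne_zero n hϖ0) hx.symm
    exact isUnit_localRing_of_ne_zero_of_subsingleton L v hvs fun h0 => hx0 (by rw [h0, Pi.zero_apply])
  have hκ := finKappaAt_eq_of_shared_eigenvector L v H' w hw hpair hpair' (hunit hχ) (hunit hχ') hne hp hp'
  have hq0 : 0 < Nat.card (𝓞 ↥(maximalRealSubfield L) ⧸ v.asIdeal) := Nat.card_pos
  have hq : ((Nat.card (𝓞 ↥(maximalRealSubfield L) ⧸ v.asIdeal) : ℂ)) ≠ 0 := by exact_mod_cast hq0.ne'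
  rw [h γH m γ' hχ hud hdd β hβ hpair, h uH m' u' hχ' hud' hdd' β' hβ' hpair', hββ', hκ, hmm, pow_add]
  field_simp

/-! ## §2 The Hilbert-symbol discharger: `β′ c² = β · ε` with `|ε − 1|_v < 1` ⇒ `(β′, θ)_v = (β, θ)_v` -/

/-- **`(β′, θ)_v = (β, θ)_v` WHEN `β′ c² = β ε`, `|ε − 1|_v < |4|_v`** (`β, c ≠ 0`): `(β′, θ) = (β′c², θ)` (★ `hilbertSymbol_mul_sq_left`) and `(βε, θ) = (β, θ)` by local
constancy (★ `hilbertSymbol_eq_of_valued_sub_lt`: `|βε − β| < |4β|`).  With `|2|_v = 1` the hypothesis reads `ε ≡ 1 (mod 𝔪_v)`; under the Cayley shift `c = ϖ_v` and `ε` is the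
product of the unit ratios of §3. [cite: Rogawski1990, §4.9 Lemma 4.9.3 p. 56] [cite: SerreLocalFields1979, Ch. XIV §3] -/
theorem hilbertSymbol_eq_of_mul_sq_eq_mul {F : Type*} [Field F] [NumberField F] (v : HeightOneSpectrum (𝓞 F))
    {β β' c ε : v.adicCompletion F} (hβ0 : β ≠ 0) (hc0 : c ≠ 0) (h : β' * c ^ 2 = β * ε)
    (hε : Valued.v (ε - 1) < Valued.v (4 : v.adicCompletion F)) (θ : v.adicCompletion F) :
    hilbertSymbol (v.adicCompletion F) β' θ = hilbertSymbol (v.adicCompletion F) β θ := by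
  rw [← hilbertSymbol_mul_sq_left β' θ hc0, h]
  refine hilbertSymbol_eq_of_valued_sub_lt F v hβ0 ?_ θ
  rw [show β * ε - β = β * (ε - 1) by ring, map_mul, map_mul, mul_comm (Valued.v (4 : v.adicCompletion F))]
  exact mul_lt_mul_of_pos_left hε ((Valuation.pos_iff _).2 hβ0)


/-! ## §3 The scalar dischargers under the Möbius shift (any valued field `K`, `|2| = 1`, `0 < |c| < 1`; trace–determinant coordinates, root-free and type-free) -/

section Scalar

variable {K : Type*} [Field K] [Valued K ℤᵐ⁰]

/-- Principal units are closed under products: `|x − 1| < 1`, `|y − 1| < 1` ⇒ `|xy − 1| < 1`. [cite: SerreLocalFields1979, Ch. IV §2] -/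
private theorem v_mul_sub_one_lt {x y : K} (hx : Valued.v (x - 1) < 1) (hy : Valued.v (y - 1) < 1) : Valued.v (x * y - 1) < 1 := by
  have hy1 : Valued.v y ≤ 1 := by
    have h := Valuation.map_add Valued.v (y - 1) 1
    rw [sub_add_cancel, map_one] at h
    exact h.trans (max_le hy.le le_rfl)
  rw [show x * y - 1 = (x - 1) * y + (y - 1) by ring]
  refine lt_of_le_of_lt (Valuation.map_add _ _ _) (max_lt ?_ hy)
  rw [map_mul]
  exact mul_lt_one_of_lt_of_le hx hy1

/-- A principal unit is a unit: `|x − 1| < 1` ⇒ `|x| = 1`. [cite: SerreLocalFields1979, Ch. IV §2] -/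
private theorem v_eq_one_of_sub_one_lt {x : K} (hx : Valued.v (x - 1) < 1) : Valued.v x = 1 := by
  have h := Valuation.map_add_eq_of_lt_left Valued.v (x := 1) (y := x - 1) (by rwa [map_one])
  rwa [add_sub_cancel, map_one] at h

/-- Principal units are closed under inverses: `|x − 1| < 1` ⇒ `|x⁻¹ − 1| < 1`. [cite: SerreLocalFields1979, Ch. IV §2] -/
private theorem v_inv_sub_one_lt {x : K} (hx : Valued.v (x - 1) < 1) : Valued.v (x⁻¹ - 1) < 1 := by
  have h1 := v_eq_one_of_sub_one_lt hx
  have hx0 : x ≠ 0 := fun h0 => by rw [h0, map_zero] at h1; exact zero_ne_one h1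
  rw [show x⁻¹ - 1 = -(x⁻¹ * (x - 1)) by field_simp; ring, Valuation.map_neg, map_mul, map_inv₀, h1, inv_one, one_mul]
  exact hx

/-- The mean of two principal units is one (`|2| = 1`): `|(x + y)∕2 − 1| < 1`. [cite: SerreLocalFields1979, Ch. IV §2] -/
private theorem v_half_add_sub_one_lt (h2 : Valued.v (2 : K) = 1) {x y : K} (hx : Valued.v (x - 1) < 1) (hy : Valued.v (y - 1) < 1) :
    Valued.v ((x + y) / 2 - 1) < 1 := by
  have h20 : (2 : K) ≠ 0 := fun h0 => by rw [h0, map_zero] at h2; exact zero_ne_one h2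
  rw [show (x + y) / 2 - 1 = ((x - 1) + (y - 1)) / 2 by field_simp; ring, map_div₀, h2, div_one]
  exact lt_of_le_of_lt (Valuation.map_add _ _ _) (max_lt hx hy)


/-- The root-free `χ`-identity under the scalar/matrix Möbius shift (2 × 2, in trace–determinant coordinates):
`χ′(u′)·(bu + a)²·det(bg + a) = (a² − b²)²·χ(u)` with `det(bg + a) = b²D + abt + a²`, `tr` and `det` of `(ag + b)(bg + a)⁻¹` as displayed (`linear_combination`;
any field, any `a, b`). [cite: Kottwitz1986, §3] [cite: Rogawski1990, §4.9 p. 55] -/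
theorem chi_moebiusShift_mul_eq {K : Type*} [Field K] (a b u t D u' t' D' : K)
    (hu' : u' * (b * u + a) = a * u + b)
    (ht' : t' * (b ^ 2 * D + a * b * t + a ^ 2) = (a ^ 2 + b ^ 2) * t + 2 * a * b * (1 + D))
    (hD' : D' * (b ^ 2 * D + a * b * t + a ^ 2) = a ^ 2 * D + a * b * t + b ^ 2) :
    (u' ^ 2 - t' * u' + D') * ((b * u + a) ^ 2 * (b ^ 2 * D + a * b * t + a ^ 2)) = (a ^ 2 - b ^ 2) ^ 2 * (u ^ 2 - t * u + D) := by
  linear_combination ((u' * (b * u + a) + (a * u + b)) * (b ^ 2 * D + a * b * t + a ^ 2) - ((a ^ 2 + b ^ 2) * t + 2 * a * b * (1 + D)) * (b * u + a)) * hu'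
    - (u' * (b * u + a) ^ 2) * ht' + (b * u + a) ^ 2 * hD'


/-- `|x − y| ≤ B < |y|` ⇒ `|x ∕ y − 1| < 1`. [cite: SerreLocalFields1979, Ch. IV §2] -/
private theorem v_div_sub_one_lt {x y : K} {B : ℤᵐ⁰} (hy : y ≠ 0) (h : Valued.v (x - y) ≤ B) (hB : B < Valued.v y) :
    Valued.v (x / y - 1) < 1 := by
  have hy0 : Valued.v y ≠ 0 := (Valuation.ne_zero_iff _).2 hy
  rw [show x / y - 1 = (x - y) / y by field_simp, map_div₀, div_lt_one₀ (zero_lt_iff.2 hy0)]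
  exact lt_of_le_of_lt h hB

/-- **THE SCALAR DISCHARGERS UNDER THE MÖBIUS SHIFT** (any valued field, `|2| = 1`, `0 < |c| < 1`, `a = c + 1`, `b = c − 1`; trace–determinant coordinates `t = tr g`,
`D = det g`, `χ(u) = u² − t u + D`; shifted data `u′ (bu + a) = au + b`, `t′·det(bg + a) = (a² + b²)t + 2ab(1 + D)`, `D′·det(bg + a) = det(ag + b)` with
`det(bg + a) = b²D + abt + a²`, `det(ag + b) = a²D + abt + b²`): if `|u − 1|, |t − 2|, |D − 1| ≤ |c|²` and `|det(g − 1)| = |D − t + 1| < |c|²` then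
(1) `|χ′(u′)| = |χ(u)| ∕ |c|²` and (2) `β′ c² = β ε` with `|ε − 1| < 1`, where `β = −χ(u)(u² + D)∕(2u²D)`, `β′` likewise — the inputs `hm′`∕`hββ′` of §1 under the Cayley∕Möbius shift
`u_H = φ_c(γ_H)`, `c = ϖ_v` (with §2 and ★ `valued_toPlace`). [cite: Kottwitz1986, §3] [cite: Rogawski1990, §4.9 p. 55, Lemma 4.9.3 p. 56] [cite: SerreLocalFields1979, Ch. IV §2] -/
theorem moebiusShift_dischargers (h2 : Valued.v (2 : K) = 1) {c : K} (hc0 : c ≠ 0) (hc1 : Valued.v c < 1)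
    {u t D u' t' D' : K}
    (hu : Valued.v (u - 1) ≤ Valued.v c ^ 2) (ht : Valued.v (t - 2) ≤ Valued.v c ^ 2) (hD : Valued.v (D - 1) ≤ Valued.v c ^ 2)
    (hDt : Valued.v (D - t + 1) < Valued.v c ^ 2)
    (hu' : u' * ((c - 1) * u + (c + 1)) = (c + 1) * u + (c - 1))
    (ht' : t' * ((c - 1) ^ 2 * D + (c + 1) * (c - 1) * t + (c + 1) ^ 2) = ((c + 1) ^ 2 + (c - 1) ^ 2) * t + 2 * (c + 1) * (c - 1) * (1 + D))
    (hD' : D' * ((c - 1) ^ 2 * D + (c + 1) * (c - 1) * t + (c + 1) ^ 2) = (c + 1) ^ 2 * D + (c + 1) * (c - 1) * t + (c - 1) ^ 2) :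
    Valued.v (u' ^ 2 - t' * u' + D') = Valued.v (u ^ 2 - t * u + D) / Valued.v c ^ 2 ∧
      ∃ ε : K, Valued.v (ε - 1) < 1 ∧
        -((u' ^ 2 - t' * u' + D') * (u' ^ 2 + D')) / (2 * u' ^ 2 * D') * c ^ 2 = -((u ^ 2 - t * u + D) * (u ^ 2 + D)) / (2 * u ^ 2 * D) * ε := by
  -- constants
  have h20 : (2 : K) ≠ 0 := fun h0 => by rw [h0, map_zero] at h2; exact zero_ne_one h2
  have hvc : 0 < Valued.v c := zero_lt_iff.2 ((Valuation.ne_zero_iff _).2 hc0)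
  have hvc2 : Valued.v c ^ 2 < Valued.v c := by
    rw [sq]; exact mul_lt_of_lt_one_left hvc hc1
  have hcm1 : Valued.v (c - 1) = 1 := by
    rw [show c - 1 = -(1 - c) by ring, Valuation.map_neg]
    exact v_eq_one_of_sub_one_lt (by rw [show (1 - c) - 1 = -c by ring, Valuation.map_neg]; exact hc1)
  have hcp1 : Valued.v (c + 1) = 1 := v_eq_one_of_sub_one_lt (by rw [add_sub_cancel_right]; exact hc1)
  have h2c : Valued.v (2 * c) = Valued.v c := by rw [map_mul, h2, one_mul]
  have h2c0 : 2 * c ≠ 0 := mul_ne_zero h20 hc0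
  have h4c2 : Valued.v (4 * c ^ 2) = Valued.v c ^ 2 := by
    rw [show (4 : K) * c ^ 2 = (2 * c) ^ 2 by ring, map_pow, h2c]
  have h4c20 : (4 : K) * c ^ 2 ≠ 0 := by rw [show (4 : K) * c ^ 2 = (2 * c) ^ 2 by ring]; exact pow_ne_zero 2 h2c0
  have h40 : (4 : K) ≠ 0 := by rw [show (4 : K) = 2 * 2 by norm_num]; exact mul_ne_zero h20 h20
  -- the four principal-unit ratios
  -- ε₄ = (bu + a)/(2c), ε₃ = (au + b)/(2c)
  have hP : Valued.v (((c - 1) * u + (c + 1)) / (2 * c) - 1) < 1 := by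
    refine v_div_sub_one_lt h2c0 (B := Valued.v c ^ 2) ?_ (by rw [h2c]; exact hvc2)
    rw [show (c - 1) * u + (c + 1) - 2 * c = (c - 1) * (u - 1) by ring, map_mul, hcm1, one_mul]; exact hu
  have hP' : Valued.v (((c + 1) * u + (c - 1)) / (2 * c) - 1) < 1 := by
    refine v_div_sub_one_lt h2c0 (B := Valued.v c ^ 2) ?_ (by rw [h2c]; exact hvc2)
    rw [show (c + 1) * u + (c - 1) - 2 * c = (c + 1) * (u - 1) by ring, map_mul, hcp1, one_mul]; exact hu
  -- ε₁ = det(bg + a)/(4c²), ε₂ = det(ag + b)/(4c²)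
  have hsmall : ∀ e : K, Valued.v e = 1 → Valued.v (e * (D - t + 1) + 2 * c * (t - 2)) < Valued.v c ^ 2 := by
    intro e he
    refine lt_of_le_of_lt (Valuation.map_add _ _ _) (max_lt ?_ ?_)
    · rw [map_mul, he, one_mul]; exact hDt
    · rw [map_mul, h2c]
      calc Valued.v c * Valued.v (t - 2) ≤ Valued.v c * Valued.v c ^ 2 := mul_le_mul' le_rfl ht
        _ < 1 * Valued.v c ^ 2 := by
          exact mul_lt_mul_of_pos_right hc1 (pow_pos hvc 2)
        _ = Valued.v c ^ 2 := one_mul _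
  have hQ : Valued.v (((c - 1) ^ 2 * D + (c + 1) * (c - 1) * t + (c + 1) ^ 2) / (4 * c ^ 2) - 1) < 1 := by
    refine v_div_sub_one_lt h4c20 (B := Valued.v ((c - 1) * ((c - 1) * (D - t + 1) + 2 * c * (t - 2)))) (le_of_eq ?_) ?_
    · congr 1; ring
    · rw [map_mul, hcm1, one_mul, h4c2]; exact hsmall _ hcm1
  have hQ' : Valued.v (((c + 1) ^ 2 * D + (c + 1) * (c - 1) * t + (c - 1) ^ 2) / (4 * c ^ 2) - 1) < 1 := by
    refine v_div_sub_one_lt h4c20 (B := Valued.v ((c + 1) * ((c + 1) * (D - t + 1) + 2 * c * (t - 2)))) (le_of_eq ?_) ?_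
    · congr 1; ring
    · rw [map_mul, hcp1, one_mul, h4c2]; exact hsmall _ hcp1
  -- names for the ratios
  set P : K := (c - 1) * u + (c + 1) with hPdef
  set P' : K := (c + 1) * u + (c - 1) with hP'def
  set Q : K := (c - 1) ^ 2 * D + (c + 1) * (c - 1) * t + (c + 1) ^ 2 with hQdef
  set Q' : K := (c + 1) ^ 2 * D + (c + 1) * (c - 1) * t + (c - 1) ^ 2 with hQ'def
  have hε₄ := v_eq_one_of_sub_one_lt hP
  have hε₃ := v_eq_one_of_sub_one_lt hP'
  have hε₁ := v_eq_one_of_sub_one_lt hQ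
  have hε₂ := v_eq_one_of_sub_one_lt hQ'
  have hvP : Valued.v P = Valued.v c := by
    have h := hε₄; rw [map_div₀, h2c, div_eq_one_iff_eq ((Valuation.ne_zero_iff _).2 hc0)] at h; exact h
  have hvP' : Valued.v P' = Valued.v c := by
    have h := hε₃; rw [map_div₀, h2c, div_eq_one_iff_eq ((Valuation.ne_zero_iff _).2 hc0)] at h; exact h
  have hvQ : Valued.v Q = Valued.v c ^ 2 := by
    have h := hε₁; rw [map_div₀, h4c2, div_eq_one_iff_eq (pow_ne_zero 2 ((Valuation.ne_zero_iff _).2 hc0))] at h; exact h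
  have hvQ' : Valued.v Q' = Valued.v c ^ 2 := by
    have h := hε₂; rw [map_div₀, h4c2, div_eq_one_iff_eq (pow_ne_zero 2 ((Valuation.ne_zero_iff _).2 hc0))] at h; exact h
  have hP0 : P ≠ 0 := fun h0 => by rw [h0, map_zero] at hvP; exact hvc.ne' hvP.symm |>.elim
  have hP'0 : P' ≠ 0 := fun h0 => by rw [h0, map_zero] at hvP'; exact hvc.ne' hvP'.symm |>.elim
  have hQ0 : Q ≠ 0 := fun h0 => by rw [h0, map_zero] at hvQ; exact (pow_pos hvc 2).ne' hvQ.symm |>.elim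
  have hQ'0 : Q' ≠ 0 := fun h0 => by rw [h0, map_zero] at hvQ'; exact (pow_pos hvc 2).ne' hvQ'.symm |>.elim
  -- the shifted data solved
  have hu'v : u' = P' / P := by rw [eq_div_iff hP0]; exact hu'
  have hD'v : D' = Q' / Q := by rw [eq_div_iff hQ0]; exact hD'
  -- (1) the `χ`-identity and its valuation
  have hχ : (u' ^ 2 - t' * u' + D') * (P ^ 2 * Q) = ((c + 1) ^ 2 - (c - 1) ^ 2) ^ 2 * (u ^ 2 - t * u + D) :=
    chi_moebiusShift_mul_eq (c + 1) (c - 1) u t D u' t' D' hu' ht' hD'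
  have h16 : ((c + 1) ^ 2 - (c - 1) ^ 2) ^ 2 = 16 * c ^ 2 := by ring
  have hv16 : Valued.v (16 : K) = 1 := by rw [show (16 : K) = 2 ^ 4 by norm_num, map_pow, h2, one_pow]
  have hχ' : u' ^ 2 - t' * u' + D' = 16 * c ^ 2 * (u ^ 2 - t * u + D) / (P ^ 2 * Q) := by
    rw [eq_div_iff (mul_ne_zero (pow_ne_zero 2 hP0) hQ0), hχ, h16]
  refine ⟨?_, ?_⟩
  · rw [hχ', map_div₀, map_mul, map_mul, map_mul, map_pow, map_pow, hv16, one_mul, hvP, hvQ]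
    have hc2 : Valued.v c ^ 2 ≠ 0 := pow_ne_zero 2 hvc.ne'
    field_simp
  -- (2) `β′ c² = β ε`
  · -- the unit `u`, `D`, `u² + D ≡ 2`, and their shifted twins
    have hu1 : Valued.v (u - 1) < 1 := lt_of_le_of_lt hu (lt_trans hvc2 hc1)
    have hD1 : Valued.v (D - 1) < 1 := lt_of_le_of_lt hD (lt_trans hvc2 hc1)
    have hu'1 : Valued.v (u' - 1) < 1 := by
      rw [hu'v, show P' / P = (P' / (2 * c)) * (P / (2 * c))⁻¹ by field_simp]
      exact v_mul_sub_one_lt hP' (v_inv_sub_one_lt hP)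
    have hD'1 : Valued.v (D' - 1) < 1 := by
      rw [hD'v, show Q' / Q = (Q' / (4 * c ^ 2)) * (Q / (4 * c ^ 2))⁻¹ by field_simp]
      exact v_mul_sub_one_lt hQ' (v_inv_sub_one_lt hQ)
    have hsq : ∀ {x : K}, Valued.v (x - 1) < 1 → Valued.v (x ^ 2 - 1) < 1 := fun hx => by rw [sq]; exact v_mul_sub_one_lt hx hx
    have hN : Valued.v ((u ^ 2 + D) / 2 - 1) < 1 := v_half_add_sub_one_lt h2 (hsq hu1) hD1
    have hN' : Valued.v ((u' ^ 2 + D') / 2 - 1) < 1 := v_half_add_sub_one_lt h2 (hsq hu'1) hD'1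
    have hu0 : u ≠ 0 := fun h0 => by rw [h0, zero_sub, Valuation.map_neg, map_one] at hu1; exact lt_irrefl _ hu1
    have hD0 : D ≠ 0 := fun h0 => by rw [h0, zero_sub, Valuation.map_neg, map_one] at hD1; exact lt_irrefl _ hD1
    have hu'0 : u' ≠ 0 := fun h0 => by rw [h0, zero_sub, Valuation.map_neg, map_one] at hu'1; exact lt_irrefl _ hu'1
    have hD'0 : D' ≠ 0 := fun h0 => by rw [h0, zero_sub, Valuation.map_neg, map_one] at hD'1; exact lt_irrefl _ hD'1
    have hN0 : (u ^ 2 + D) / 2 ≠ 0 := fun h0 => by rw [h0, zero_sub, Valuation.map_neg, map_one] at hN; exact lt_irrefl _ hN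
    have hN0' : u ^ 2 + D ≠ 0 := fun h0 => hN0 (by rw [h0, zero_div])
    -- the unit `ε`
    refine ⟨((u' ^ 2 + D') / 2) * (u ^ 2 * D) * (((u ^ 2 + D) / 2) * (u' ^ 2 * D') * ((P / (2 * c)) ^ 2 * (Q / (4 * c ^ 2))))⁻¹, ?_, ?_⟩
    · refine v_mul_sub_one_lt (v_mul_sub_one_lt hN' (v_mul_sub_one_lt (hsq hu1) hD1)) (v_inv_sub_one_lt ?_)
      exact v_mul_sub_one_lt (v_mul_sub_one_lt hN (v_mul_sub_one_lt (hsq hu'1) hD'1)) (v_mul_sub_one_lt (hsq hP) hQ)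
    · rw [hχ']
      field_simp
      ring


end Scalar

end Literature.NumberTheory.Rogawski1990

end
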